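import Literature.Computability.Complexity.PaulPippengerSzemerediTrotter1983Collapse
import Literature.Computability.Complexity.PaulPippengerSzemerediTrotter1983Padding
import HarnessLib

/-!
# Bounded-quantifier normal form for the linear-time hierarchy: `∃∀…`-protocols over `DTIME(n)` are in `ΣₖTIME(n)`

Literature / complexity toolkit, companion of `…Collapse.lean` (the levels `sigmaLin k`,
`piLin k`) serving the inline formalization of Paul–Pippenger–Szemerédi–Trotter 1983
(`PaulPippengerSzemerediTrotter1983.lean`, fact `PaulEtAl1983_NTIME_not_subset_DTIME`): the
remaining hypothesis of the assembly (`…Proofs.lean`) is the four-alternation speed-up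
`DTIME(n (log* n + 1)) ⊆ sigmaLin 4`, and any proof of it must PLACE a concrete alternating
linear-time protocol ("guess the block boundaries and the segregator, for every block guess its
few ancestors, check one of them deterministically") in `sigmaLin 4`. The levels are defined by
iterating the operator `linExists ∘ co`, whose windows refer to the length of the CURRENT nested
pair word, while a protocol bounds all its witnesses by the length of the ORIGINAL input; this file
bridges the two once and for all:

* `QSigma k c n₀ V w` — `k` alternating quantifiers, `∃` first, each over words of length
  `≤ c n₀ + c`, appended by the pair code, ending in the predicate `V`
  (`QSigma (k+1) c n₀ V w = ∃ y, |y| ≤ c n₀ + c ∧ ¬ QSigma k c n₀ Vᶜ ⟨w, y⟩`): the predicate form of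
  `ΣₖTIME(n)` (Santhanam 2001, §2, proof of Lemma 2.3);
* `LinMap φ` (some `TM2` machine computes `φ` in linear time; `linMap_id`,
  `LinMap.exists_length_le`), `WindowClock c ℓ` (some machine maps `w ↦ ⟨w, 1^{c ℓ(w) + c}⟩` in
  linear time; `windowClock_length` = `exists_window_clock`) — definitions with bodies, the data
  threaded through the induction;
* `preimage_mem_DTIME_id` — `DTIME(n)` is closed under linear-time preimages;
* stack programs (`Com`, compiled by `Com.outputsWithin_of_runs_equiv`): `Com.dblBits`,
  `QuantProg.fstTagProg : z ↦ ⟨(boolUnpair z).1, z⟩`, `QuantProg.swapDropProg : ⟨⟨a, p⟩, u⟩ ↦ ⟨u, p⟩`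
  with exact costs and their machines;
* the two constructions of the inductive step: `WindowClock.fst` (a clock for
  `ℓ ∘ fst`: tag, clock the tag with the word parked — `mapFstAux` —, swap-and-drop) and
  `LinMap.cutPair` (the map `u ↦ ⟨φ (fst u), rest u ↾ (c ℓ(fst u) + c)⟩`: the truncating wrapper
  `truncMapAux` over "clock, then `φ` on the first component");
* **`qSigma_mem_sigmaLin`**: `{w | QSigma k c (ℓ w) V (φ w)} ∈ sigmaLin k` for `V ∈ DTIME(n)`,
  linear-time `φ`, clocked `ℓ ≤ |·|` — induction on `k`, the outermost quantifier becoming the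
  `linExists` of the level (window `c|w| + c ⊇ c ℓ(w) + c`, the slack CUT inside the pair
  language), the complement of the pair language being of the same shape one level down
  (`co_DTIME`, `LinMap.cutPair`, `WindowClock.fst`);
* **`setOf_qSigma_mem_sigmaLin`**: `{x | QSigma k c |x| V x} ∈ sigmaLin k` — the user form.

No named fact is introduced (definitions with bodies and theorems only).

## References

* R. Santhanam, *On separators, segregators and time versus space*, CCC 2001, §2, proof of
  Lemma 2.3 (the predicate form `x ∈ L ≡ ∀^{O(|x|)} y ∃^{O(t(|x|))} z R(x, y, z)` of a `Π₂` linear-time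
  computation) [Santhanam2001].
* W. J. Paul, N. Pippenger, E. Szemerédi, W. T. Trotter, *On determinism versus non-determinism
  and related problems*, FOCS 1983, §3–4 (the `Σ₄` simulation) [PaulEtAl1983].
* S. Arora, B. Barak, *Computational Complexity: A Modern Approach*, CUP 2009, Def. 5.3 /
  Remark 5.8 (levels by bounded quantifiers), Thm. 2.6, §1.3 [AroraBarakCC2009].
-/

namespace Literature.Computability.Complexity

open _root_.Computability Turing PairFstTM

/-! ### Alternating linearly bounded quantifiers over a predicate -/

/-- **`k` alternating linearly bounded quantifiers, `∃` first**, over the predicate (language)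
`V`, with all witness lengths bounded by `c n₀ + c` for a fixed parameter `n₀` (the length of the
original input) and the witnesses appended by the pair code:
`QSigma 0 c n₀ V w = (w ∈ V)`, `QSigma (k+1) c n₀ V w = ∃ y, |y| ≤ c n₀ + c ∧ ¬ QSigma k c n₀ Vᶜ ⟨w, y⟩`
— so `QSigma 2 c n₀ V x = ∃ y₁ ∀ y₂, ⟨⟨x, y₁⟩, y₂⟩ ∈ V` over the bounded `yᵢ`, etc. (the predicate
form of `ΣₖTIME(n)`, Santhanam 2001, §2, proof of Lemma 2.3). [cite: Santhanam2001, §2 (proof of Lemma 2.3: the predicate form)] -/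
def QSigma : ℕ → ℕ → ℕ → Language Bool → List Bool → Prop
  | 0, _, _, V, w => w ∈ V
  | k + 1, c, n₀, V, w => ∃ y : List Bool, y.length ≤ c * n₀ + c ∧ ¬ QSigma k c n₀ Vᶜ (boolPair w y)

/-- `QSigma 0` (definitional). [folklore] -/
@[simp] theorem qSigma_zero (c n₀ : ℕ) (V : Language Bool) (w : List Bool) :
    QSigma 0 c n₀ V w ↔ w ∈ V := Iff.rfl

/-- `QSigma (k+1)` (definitional). [folklore] -/
theorem qSigma_succ (k c n₀ : ℕ) (V : Language Bool) (w : List Bool) :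
    QSigma (k + 1) c n₀ V w ↔
      ∃ y : List Bool, y.length ≤ c * n₀ + c ∧ ¬ QSigma k c n₀ Vᶜ (boolPair w y) := Iff.rfl

/-! ### Linear-time maps and window clocks (the data threaded through the induction) -/

/-- `LinMap φ`: some `TM2` machine computes the string function `φ` in linear time. [folklore] -/
def LinMap (φ : List Bool → List Bool) : Prop :=
  ∃ (F : TM2ComputableAux Bool Bool) (a : ℕ), ∀ w : List Bool, F.OutputsWithin w (φ w) (a * w.length + a)

/-- `WindowClock c ℓ`: some `TM2` machine maps every `w` to `⟨w, 1^{c ℓ(w) + c}⟩` in linear time.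
[folklore] -/
def WindowClock (c : ℕ) (ℓ : List Bool → ℕ) : Prop :=
  ∃ (K : TM2ComputableAux Bool Bool) (a : ℕ), ∀ w : List Bool,
    K.OutputsWithin w (boolPair w (List.replicate (c * ℓ w + c) true)) (a * w.length + a)

/-- A linear-time map has linearly bounded output length. [folklore] -/
theorem LinMap.exists_length_le {φ : List Bool → List Bool} (h : LinMap φ) :
    ∃ C : ℕ, ∀ w, (φ w).length ≤ C * w.length + C := by
  obtain ⟨F, a, hF⟩ := h
  refine ⟨1 + TM2Comp.machinePushBound F.tm * a, fun w => ?_⟩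
  have := TM2Comp.length_le_of_outputsWithin F (hF w)
  nlinarith [this, Nat.zero_le (TM2Comp.machinePushBound F.tm * w.length)]

/-- The identity is a linear-time map (the stack program "pour twice"). [folklore] -/
theorem linMap_id : LinMap (fun w : List Bool => w) := by
  -- the identity as the stack program "pour twice"
  refine ⟨(Com.compile ((Com.pour AReg.x AReg.s ;; Com.pour AReg.s AReg.y).map
    (Fintype.equivFin AReg))).toAux (Fintype.equivFin AReg .x) (Fintype.equivFin AReg .y), 7,
    fun w => ?_⟩
  have h1 := Com.runs_pour (a := AReg.x) (b := AReg.s) (by decide) (AReg.file w [] [] [] [] [] [] [])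
  simp only [AReg.file_x, AReg.file_s, List.append_nil, AReg.update_file_x, AReg.update_file_s] at h1
  have h2 := Com.runs_pour (a := AReg.s) (b := AReg.y) (by decide) (AReg.file [] [] [] w.reverse [] [] [] [])
  simp only [AReg.file_s, AReg.file_y, List.reverse_reverse, List.append_nil, List.length_reverse,
    AReg.update_file_s, AReg.update_file_y] at h2
  have h : Com.Runs (Com.pour AReg.x AReg.s ;; Com.pour AReg.s AReg.y) (AReg.file w [] [] [] [] [] [] [])
      (AReg.file [] w [] [] [] [] [] []) (3 * w.length + 1 + (3 * w.length + 1)) := h1.seq h2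
  rw [← Com.init_x_eq_file, ← Com.init_y_eq_file] at h
  have hc := Com.outputsWithin_of_runs_equiv (Fintype.equivFin AReg) (Or.inl h)
  exact hc.mono (by omega)

/-- The length parameter has window clocks for every `c` (`exists_window_clock`). [folklore] -/
theorem windowClock_length (c : ℕ) : WindowClock c (fun w : List Bool => w.length) :=
  exists_window_clock c

/-! ### The base level: linear-time preimages of `DTIME(n)` languages -/

/-- **`DTIME(n)` is closed under linear-time preimages.** [cite: AroraBarakCC2009, §1.3 (composition of machines)] -/
theorem preimage_mem_DTIME_id {V : Language Bool} (hV : V ∈ DTIME (fun n => n)) {φ : List Bool → List Bool}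
    (hφ : LinMap φ) : {w | φ w ∈ V} ∈ DTIME (fun n => n) := by
  obtain ⟨C, hC⟩ := hφ.exists_length_le
  obtain ⟨F, a, hF⟩ := hφ
  obtain ⟨b, hdec⟩ := hV
  obtain ⟨M, hM⟩ := (hdec : TimeDecidable id V fun n => b * n + b)
  refine ⟨a + b * C + b, F.comp M, fun w => ?_⟩
  have h₁ := hF w
  have h₂ := hM (φ w)
  have hind : ({w | φ w ∈ V} : Language Bool).boolIndicator w = V.boolIndicator (φ w) := by
    have h1 : ∀ (s : Set (List Bool)) (v : List Bool), s.boolIndicator v = true ↔ v ∈ s :=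
      fun s v => (Set.mem_iff_boolIndicator s v).symm
    rw [Bool.eq_iff_iff, h1, h1]
    rfl
  simp only [id] at h₂ ⊢
  rw [hind]
  have h := Turing.TM2ComputableAux.comp_outputsWithin _ _ h₁ h₂
  refine h.mono ?_
  have := hC w
  nlinarith [this, Nat.zero_le (b * w.length)]

/-! ### Two more stack programs: tagging with the first component, and swap-and-drop -/

namespace Com

section Generic

variable {ι : Type} [DecidableEq ι]

/-- `dblBits src dst`: pop `src`, pushing every symbol twice on `dst`. [folklore] -/
def dblBits (src dst : ι) : Com ι :=
  loop src (push dst true ;; push dst true) (push dst false ;; push dst false)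

/-- Effect of `dblBits` on `src = w` (cost `≤ 4|w| + 1`): `dst := dup (w.reverse) ++ dst` where
`dup` doubles every symbol, `src` emptied. [folklore] -/
theorem runs_dblBits {src dst : ι} (hsd : src ≠ dst) : ∀ (w : List Bool) (R : Regs ι), R src = w →
    Runs (dblBits src dst) R
      (Function.update (Function.update R src []) dst
        ((w.reverse.flatMap fun b => [b, b]) ++ R dst)) (4 * w.length + 1)
  | [], R, hw => by
    refine (Runs.loop_nil _ _ hw).of_eq ?_ (by simp)
    ext i : 1
    simp only [Function.update_apply, List.reverse_nil, List.flatMap_nil, List.nil_append]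
    split_ifs <;> simp_all
  | b :: w, R, hw => by
    set R₁ := Function.update (Function.update R src w) dst (b :: b :: R dst) with hR₁
    have hbody : Runs (push dst b ;; push dst b) (Function.update R src w) R₁ (1 + 1) := by
      refine ((Runs.push dst b _).seq (Runs.push dst b _)).of_eq ?_ le_rfl
      simp [hR₁, Function.update_of_ne hsd.symm]
    have ih := runs_dblBits hsd w R₁ (by simp [hR₁, Function.update_of_ne hsd])
    have e : Function.update (Function.update R₁ src []) dst
          ((w.reverse.flatMap fun b => [b, b]) ++ R₁ dst) =
        Function.update (Function.update R src []) dst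
          (((b :: w).reverse.flatMap fun b => [b, b]) ++ R dst) := by
      ext i : 1
      simp only [hR₁, Function.update_apply, List.reverse_cons, List.flatMap_append,
        List.flatMap_cons, List.flatMap_nil, List.append_nil, List.append_assoc, List.cons_append,
        List.nil_append]
      split_ifs <;> simp_all
    cases b
    · exact (Runs.loop_false (w := w) hw hbody ih).of_eq e (by simp; omega)
    · exact (Runs.loop_true (w := w) hw hbody ih).of_eq e (by simp; omega)

end Generic

end Com

/-- `⟨a, b⟩ = dup a ++ 0 1 b` (local copy of `MachineB.boolPair_eq_flatMap`). [folklore] -/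
private theorem boolPair_eq_flatMap (a b : List Bool) :
    boolPair a b = (a.flatMap fun c => [c, c]) ++ false :: true :: b := by
  simp [boolPair]

namespace QuantProg

open Com AReg

/-- **Tagging with the first component**: `z ↦ ⟨(boolUnpair z).1, z⟩` (input and output on `x`):
copy `z`, read the first component of the copy, emit it doubled in front of the separator.
[folklore] -/
def fstTagProg : Com AReg :=
  pour .x .s ;; PadLin.dupLoop ;; prs .y .z .t ;; clear .t ;; push .x true ;; push .x false ;; dblBits .z .x

/-- Effect of `fstTagProg` (cost `≤ 16|z| + 10`). [folklore] -/
theorem runs_fstTagProg (z : List Bool) :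
    Runs fstTagProg (file z [] [] [] [] [] [] []) (file (boolPair (boolUnpair z).1 z) [] [] [] [] [] [] [])
      (16 * z.length + 10) := by
  have h1 := runs_pour (a := AReg.x) (b := AReg.s) (by decide) (file z [] [] [] [] [] [] [])
  simp only [file_x, file_s, List.append_nil, update_file_x, update_file_s] at h1
  have h2 := PadLin.runs_dupLoop z.reverse [] [] [] [] [] [] []
  simp only [List.reverse_reverse, List.append_nil, List.length_reverse] at h2
  have h3 := runs_prs (src := AReg.y) (dst := AReg.z) (tmp := AReg.t) (by decide) (by decide)
    (by decide) z (file z z [] [] [] [] [] []) (by simp) (by simp)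
  simp only [file_z, List.append_nil, update_file_y, update_file_z, update_file_t] at h3
  have h4 := runs_clear AReg.t (file z [] (boolUnpair z).1.reverse [] (readRest z).reverse [] [] [])
  simp only [file_t, List.length_reverse, update_file_t] at h4
  have h5a : Runs (push AReg.x true) (file z [] (boolUnpair z).1.reverse [] [] [] [] [])
      (file (true :: z) [] (boolUnpair z).1.reverse [] [] [] [] []) 1 :=
    (Runs.push AReg.x true _).of_eq (by simp) le_rfl
  have h5b : Runs (push AReg.x false) (file (true :: z) [] (boolUnpair z).1.reverse [] [] [] [] [])
      (file (false :: true :: z) [] (boolUnpair z).1.reverse [] [] [] [] []) 1 :=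
    (Runs.push AReg.x false _).of_eq (by simp) le_rfl
  have h6 := runs_dblBits (src := AReg.z) (dst := AReg.x) (by decide) (boolUnpair z).1.reverse
    (file (false :: true :: z) [] (boolUnpair z).1.reverse [] [] [] [] []) (by simp)
  simp only [file_x, List.reverse_reverse, update_file_z, update_file_x, List.length_reverse] at h6
  have hl := Com.length_readRest_add_le z
  refine (h1.seq (h2.seq (h3.seq (h4.seq (h5a.seq (h5b.seq h6)))))).of_eq ?_ ?_
  · rw [boolPair_eq_flatMap]
  · omega

/-- **Swap-and-drop**: a word `v` read as `⟨⟨a, p⟩, u⟩` is sent to `⟨u, p⟩` (input on `x`, output on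
`u`): read the outer pair (first component reversed on `y`, `u` reversed on `t`), restore the
first component and read it again (`a` dropped, `p` reversed on `g`), then emit `p`, the
separator and `u` doubled. [folklore] -/
def swapDropProg : Com AReg :=
  prs .x .y .t ;; pour .y .s ;; prs .s .z .g ;; clear .z ;; pour .g .u ;; push .u true ;; push .u false ;;
  dblBits .t .u

/-- The function computed by `swapDropProg`. [folklore] -/
def swapDropFn (v : List Bool) : List Bool :=
  boolPair (readRest v) (readRest (boolUnpair v).1)

/-- On `⟨⟨a, p⟩, u⟩` the swap-and-drop is `⟨u, p⟩`. [folklore] -/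
@[simp] theorem swapDropFn_boolPair (a p u : List Bool) :
    swapDropFn (boolPair (boolPair a p) u) = boolPair u p := by
  simp [swapDropFn]

/-- Effect of `swapDropProg` (cost `≤ 20|v| + 16`). [folklore] -/
theorem runs_swapDropProg (v : List Bool) :
    Runs swapDropProg (file v [] [] [] [] [] [] []) (file [] [] [] [] [] (swapDropFn v) [] [])
      (20 * v.length + 16) := by
  set B := (boolUnpair v).1 with hB
  set u := readRest v with hu
  set a := (boolUnpair B).1 with ha
  set p := readRest B with hp
  have hlv := Com.length_readRest_add_le v
  have hlB := Com.length_readRest_add_le B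
  rw [← hB, ← hu] at hlv
  rw [← ha, ← hp] at hlB
  have h1 := runs_prs (src := AReg.x) (dst := AReg.y) (tmp := AReg.t) (by decide) (by decide)
    (by decide) v (file v [] [] [] [] [] [] []) (by simp) (by simp)
  simp only [file_y, List.append_nil, update_file_x, update_file_y, update_file_t, ← hB, ← hu] at h1
  have h2 := runs_pour (a := AReg.y) (b := AReg.s) (by decide) (file [] B.reverse [] [] u.reverse [] [] [])
  simp only [file_y, file_s, List.reverse_reverse, List.append_nil, List.length_reverse,
    update_file_y, update_file_s] at h2
  have h3 := runs_prs (src := AReg.s) (dst := AReg.z) (tmp := AReg.g) (by decide) (by decide)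
    (by decide) B (file [] [] [] B u.reverse [] [] []) (by simp) (by simp)
  simp only [file_z, List.append_nil, update_file_s, update_file_z, update_file_g, ← ha, ← hp] at h3
  have h4 := runs_clear AReg.z (file [] [] a.reverse [] u.reverse [] [] p.reverse)
  simp only [file_z, List.length_reverse, update_file_z] at h4
  have h5 := runs_pour (a := AReg.g) (b := AReg.u) (by decide) (file [] [] [] [] u.reverse [] [] p.reverse)
  simp only [file_g, file_u, List.reverse_reverse, List.append_nil, List.length_reverse,
    update_file_g, update_file_u] at h5
  have h6a : Runs (push AReg.u true) (file [] [] [] [] u.reverse p [] [])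
      (file [] [] [] [] u.reverse (true :: p) [] []) 1 := (Runs.push AReg.u true _).of_eq (by simp) le_rfl
  have h6b : Runs (push AReg.u false) (file [] [] [] [] u.reverse (true :: p) [] [])
      (file [] [] [] [] u.reverse (false :: true :: p) [] []) 1 :=
    (Runs.push AReg.u false _).of_eq (by simp) le_rfl
  have h7 := runs_dblBits (src := AReg.t) (dst := AReg.u) (by decide) u.reverse
    (file [] [] [] [] u.reverse (false :: true :: p) [] []) (by simp)
  simp only [file_u, List.reverse_reverse, update_file_t, update_file_u, List.length_reverse] at h7
  refine (h1.seq (h2.seq (h3.seq (h4.seq (h5.seq (h6a.seq (h6b.seq h7))))))).of_eq ?_ ?_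
  · simp only [swapDropFn, ← hu, ← hB, ← hp, boolPair_eq_flatMap]
  · omega

/-- `Regs.init .u` on the bank. [folklore] -/
theorem init_u_eq_file (w : List Bool) : Regs.init AReg.u w = file [] [] [] [] [] w [] [] := by
  funext r; cases r <;> rfl

/-- **The first-component tagging machine**: `z ↦ ⟨(boolUnpair z).1, z⟩` within `16|z| + 11`
steps. [folklore] -/
theorem exists_fstTag_machine : ∃ T : TM2ComputableAux Bool Bool, ∀ z : List Bool,
    T.OutputsWithin z (boolPair (boolUnpair z).1 z) (16 * z.length + 11) := by
  refine ⟨(compile (fstTagProg.map (Fintype.equivFin AReg))).toAux (Fintype.equivFin AReg .x)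
    (Fintype.equivFin AReg .x), fun z => ?_⟩
  have h := runs_fstTagProg z
  rw [← Com.init_x_eq_file, ← Com.init_x_eq_file] at h
  exact Com.outputsWithin_of_runs_equiv (Fintype.equivFin AReg) (Or.inl h)

/-- **The swap-and-drop machine**: `v ↦ swapDropFn v` within `20|v| + 17` steps. [folklore] -/
theorem exists_swapDrop_machine : ∃ S : TM2ComputableAux Bool Bool, ∀ v : List Bool,
    S.OutputsWithin v (swapDropFn v) (20 * v.length + 17) := by
  refine ⟨(compile (swapDropProg.map (Fintype.equivFin AReg))).toAux (Fintype.equivFin AReg .x)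
    (Fintype.equivFin AReg .u), fun v => ?_⟩
  have h := runs_swapDropProg v
  rw [← Com.init_x_eq_file, ← init_u_eq_file] at h
  exact Com.outputsWithin_of_runs_equiv (Fintype.equivFin AReg) (Or.inl h)

end QuantProg

/-! ### The two constructions of the inductive step -/

/-- **The window clock of the next level.** From a window clock for `ℓ` (constant `c`, `ℓ ≤ |·|`)
one for `ℓ' u = ℓ (boolUnpair u).1`: tag `u` with its first component, run the clock on the tag
with `u` parked (`mapFstAux`), swap and drop. [folklore] -/
theorem WindowClock.fst {c : ℕ} {ℓ : List Bool → ℕ} (h : WindowClock c ℓ) (hℓ : ∀ w, ℓ w ≤ w.length) :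
    WindowClock c (fun u => ℓ (boolUnpair u).1) := by
  obtain ⟨K, a, hK⟩ := h
  obtain ⟨T, hT⟩ := QuantProg.exists_fstTag_machine
  obtain ⟨S, hS⟩ := QuantProg.exists_swapDrop_machine
  refine ⟨T.comp ((mapFstAux K).comp S), 200 * (a + c + 1), fun u => ?_⟩
  set x := (boolUnpair u).1 with hx
  have hxl : x.length ≤ u.length := by
    have := Com.length_readRest_add_le u
    rw [← hx] at this
    omega
  have hℓx : ℓ x ≤ u.length := (hℓ x).trans hxl
  have h₁ := hT u
  rw [← hx] at h₁
  have h₂ : (mapFstAux K).OutputsWithin (boolPair x u)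
      (boolPair (boolPair x (List.replicate (c * ℓ x + c) true)) u)
      (a * x.length + a + 3 * (boolPair x (List.replicate (c * ℓ x + c) true)).length +
        2 * (boolPair x u).length + 6) := by
    have := outputsWithin_mapFstAux K (z := boolPair x u)
      (out := boolPair x (List.replicate (c * ℓ x + c) true)) (m := a * x.length + a)
      (by simpa using hK x)
    simpa only [readRest_boolPair] using this
  have h₃ : S.OutputsWithin (boolPair (boolPair x (List.replicate (c * ℓ x + c) true)) u)
      (boolPair u (List.replicate (c * ℓ x + c) true))
      (20 * (boolPair (boolPair x (List.replicate (c * ℓ x + c) true)) u).length + 17) := by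
    simpa only [QuantProg.swapDropFn_boolPair] using
      hS (boolPair (boolPair x (List.replicate (c * ℓ x + c) true)) u)
  have h₂₃ := Turing.TM2ComputableAux.comp_outputsWithin _ _ h₂ h₃
  have h := Turing.TM2ComputableAux.comp_outputsWithin _ _ h₁ h₂₃
  refine h.mono ?_
  simp only [length_boolPair, List.length_replicate]
  have hcl : c * ℓ x ≤ c * u.length := Nat.mul_le_mul_left c hℓx
  have hax : a * x.length ≤ a * u.length := Nat.mul_le_mul_left a hxl
  nlinarith [hcl, hax, hxl, hℓx, Nat.zero_le (a * u.length), Nat.zero_le (c * u.length)]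

/-- **The map of the next level.** From a linear-time `φ` and a window clock for `ℓ`, the map
`φ' u = ⟨φ (boolUnpair u).1, readRest u ↾ (c ℓ((boolUnpair u).1) + c)⟩` is linear time: the
truncating wrapper (`truncMapAux`) over "clock, then `φ` on the first component" (`mapFstAux`).
[folklore] -/
theorem LinMap.cutPair {φ : List Bool → List Bool} (hφ : LinMap φ) {c : ℕ} {ℓ : List Bool → ℕ}
    (hK : WindowClock c ℓ) (hℓ : ∀ w, ℓ w ≤ w.length) :
    LinMap (fun u => boolPair (φ (boolUnpair u).1)
      ((readRest u).take (c * ℓ (boolUnpair u).1 + c))) := by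
  obtain ⟨C, hC⟩ := hφ.exists_length_le
  obtain ⟨F, a, hF⟩ := hφ
  obtain ⟨K, b, hK⟩ := hK
  refine ⟨truncMapAux (K.comp (mapFstAux F)), 100 * (a + b + c + C + 1), fun u => ?_⟩
  set x := (boolUnpair u).1 with hx
  have hl := Com.length_readRest_add_le u
  rw [← hx] at hl
  have hxl : x.length ≤ u.length := by omega
  have hℓx : ℓ x ≤ u.length := (hℓ x).trans hxl
  -- `N = K ⨟ mapFstAux F` on `x`
  have hN₁ := hK x
  have hN₂ : (mapFstAux F).OutputsWithin (boolPair x (List.replicate (c * ℓ x + c) true))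
      (boolPair (φ x) (List.replicate (c * ℓ x + c) true))
      (a * x.length + a + 3 * (φ x).length +
        2 * (boolPair x (List.replicate (c * ℓ x + c) true)).length + 6) := by
    have := outputsWithin_mapFstAux F (z := boolPair x (List.replicate (c * ℓ x + c) true))
      (out := φ x) (m := a * x.length + a) (by simpa using hF x)
    simpa only [readRest_boolPair] using this
  have hN := Turing.TM2ComputableAux.comp_outputsWithin _ _ hN₁ hN₂
  have h := outputsWithin_truncMapAux (K.comp (mapFstAux F)) (z := u) (a := φ x)
    (u := List.replicate (c * ℓ x + c) true) (by rw [← hx]; exact hN)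
  rw [List.length_replicate] at h
  refine h.mono ?_
  simp only [length_boolPair, List.length_replicate]
  have hφl : (φ x).length ≤ C * u.length + C := (hC x).trans (by nlinarith [hxl])
  have hcl : c * ℓ x ≤ c * u.length := Nat.mul_le_mul_left c hℓx
  have hax : a * x.length ≤ a * u.length := Nat.mul_le_mul_left a hxl
  have hbx : b * x.length ≤ b * u.length := Nat.mul_le_mul_left b hxl
  have hr : (readRest u).length / 2 ≤ u.length := (Nat.div_le_self _ _).trans (by omega)
  nlinarith [hφl, hcl, hax, hbx, hr, Nat.sub_le u.length (readRest u).length,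
    Nat.zero_le (a * u.length), Nat.zero_le (b * u.length), Nat.zero_le (c * u.length),
    Nat.zero_le (C * u.length)]

/-! ### The normal form theorem -/

/-- **Alternating linearly bounded quantifiers over a `DTIME(n)` predicate define languages of
the linear-time hierarchy** — the induction, threaded with a linear-time map `φ` applied to the
input and a length parameter `ℓ ≤ |·|` with window clocks:
`{w | QSigma k c (ℓ w) V (φ w)} ∈ sigmaLin k`. Step: the outermost `∃ y, |y| ≤ c ℓ(w) + c` is the
`linExists` of `sigmaLin (k+1)` (window `c|w| + c ⊇ c ℓ(w) + c`) over the pair language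
`L' = {u | ¬ QSigma k c (ℓ x) Vᶜ ⟨φ x, y ↾ (c ℓ x + c)⟩}` (`u` read as `⟨x, y⟩`), whose complement is
of the same shape one level down, with `Vᶜ ∈ DTIME(n)` (`co_DTIME`), the map `LinMap.cutPair`
and the clock `WindowClock.fst`. [cite: Santhanam2001, §2 (proof of Lemma 2.3: predicate form of ΣₖTIME)]
[cite: AroraBarakCC2009, Def. 5.3 and Thm. 2.6] -/
theorem qSigma_mem_sigmaLin : ∀ (k c : ℕ) (V : Language Bool), V ∈ DTIME (fun n => n) →
    ∀ (φ : List Bool → List Bool) (ℓ : List Bool → ℕ), LinMap φ → WindowClock c ℓ →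
      (∀ w, ℓ w ≤ w.length) → {w | QSigma k c (ℓ w) V (φ w)} ∈ sigmaLin k
  | 0, c, V, hV, φ, ℓ, hφ, hK, hℓ => by
    simpa [QSigma] using preimage_mem_DTIME_id hV hφ
  | k + 1, c, V, hV, φ, ℓ, hφ, hK, hℓ => by
    rw [sigmaLin_succ, piLin]
    -- the pair language of the step
    let L' : Language Bool := {u | ¬ QSigma k c (ℓ (boolUnpair u).1) Vᶜ
      (boolPair (φ (boolUnpair u).1) ((readRest u).take (c * ℓ (boolUnpair u).1 + c)))}
    have hmem : ∀ u, u ∈ L' ↔ ¬ QSigma k c (ℓ (boolUnpair u).1) Vᶜ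
        (boolPair (φ (boolUnpair u).1) ((readRest u).take (c * ℓ (boolUnpair u).1 + c))) :=
      fun u => Iff.rfl
    have hVc : Vᶜ ∈ DTIME (fun n => n) := compl_mem_DTIME_iff.2 hV
    have ih := qSigma_mem_sigmaLin k c Vᶜ hVc _ _ (hφ.cutPair hK hℓ) (hK.fst hℓ)
      (fun u => (hℓ _).trans (by have := Com.length_readRest_add_le u; omega))
    refine ⟨L', ?_, c, fun x => ?_⟩
    · -- `L' ∈ co (sigmaLin k)`: its complement is the level-`k` set of the induction hypothesis
      show L'ᶜ ∈ sigmaLin k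
      have e : L'ᶜ = {u | QSigma k c (ℓ (boolUnpair u).1) Vᶜ
          (boolPair (φ (boolUnpair u).1) ((readRest u).take (c * ℓ (boolUnpair u).1 + c)))} := by
        apply Set.ext
        intro u
        show ¬ (u ∈ L') ↔ _
        rw [hmem, not_not]
        rfl
      rw [e]
      exact ih
    · -- membership
      show QSigma (k + 1) c (ℓ x) V (φ x) ↔ _
      rw [qSigma_succ]
      constructor
      · rintro ⟨y, hy, hQ⟩
        have hy' : y.length ≤ c * x.length + c :=
          hy.trans (Nat.add_le_add_right (Nat.mul_le_mul_left c (hℓ x)) c)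
        refine ⟨y, hy', ?_⟩
        rw [hmem]
        simpa [boolUnpair_boolPair, readRest_boolPair, List.take_of_length_le hy] using hQ
      · rintro ⟨y, -, hu⟩
        rw [hmem] at hu
        simp only [boolUnpair_boolPair, readRest_boolPair] at hu
        exact ⟨y.take (c * ℓ x + c), List.length_take_le _ _, hu⟩

/-- **Bounded-quantifier normal form, user form**: for `V ∈ DTIME(n)` and constants `k`, `c`,
the language `{x | ∃ y₁ ∀ y₂ … Q yₖ, |yᵢ| ≤ c|x| + c, ⟨…⟨⟨x, y₁⟩, y₂⟩…, yₖ⟩ ∈ V (alternating)}` is in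
`sigmaLin k` = `ΣₖTIME(n)`. This is the entry point for placing a concrete alternating linear-time
protocol (such as PPST's four-alternation re-simulation) in the hierarchy of `…Collapse.lean`.
[cite: Santhanam2001, §2 (proof of Lemma 2.3)] [cite: PaulEtAl1983, §3–4] -/
theorem setOf_qSigma_mem_sigmaLin (k c : ℕ) {V : Language Bool} (hV : V ∈ DTIME (fun n => n)) :
    {x | QSigma k c x.length V x} ∈ sigmaLin k :=
  qSigma_mem_sigmaLin k c V hV (fun w => w) (fun w => w.length) linMap_id (windowClock_length c)
    (fun _ => le_rfl)

end Literature.Computability.Complexity
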